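/-
Copyright: statement-level skeleton of a published paper (lit-balaban cell, Phase-2 proof seat p37 gen 108). No claims beyond
what the kernel checks below.
-/
import Mathlib
import Literature.MathematicalPhysics.QuantumFieldTheory.Balaban1983to89.B3GraphAmplitude

/-!
# B3 — T. Bałaban, *(Higgs)₂,₃ quantum fields in a finite volume. III. Renormalization*, CMP **88** (1983) 411–445
[Balaban1983Higgs3], pp. 414–416 [PDF 4–6]: **the line calculus of p26's leg pairings** — per-line kernels ↔ oriented pair
kernels, independence of the line product from the rank that picks the line representatives, the JOINT pairing of two leg
species glued along ONE new line and the splitting of its line product (FILE K1 of the cutting rule for (1.21); FILE K2 =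
`B3GraphGlueAmplitude`: the amplitude of p37's glued graph `B3GraphGlue.glue` on p26's evaluator `B3GraphAmplitude.amp`)

statement-level skeleton of published theorems with citation tags; proofs where landed; nothing here is a claim about
the Yang–Mills mass gap

PDF held: `paper:balaban1983-higgs-2-3-quantum-fields-finite-volume` (journal page = PDF page + 410); pp. 414–416 read on the ×2
renders `run/shared/lean/pub/pub-balaban/b2b-balaban-ref1/pages/1983-cmp88-higgs23-III/…-p004,p005,p006-x2.png`.

CITATION HEADER (lean-in-tree rule).  lit-balaban TYPED SKELETON (HOME `run/shared/lean/pub/lit-balaban/`), PHASE 2, seat p37 gen 108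
(unit `lit-balaban-p37`; TAKING (K), HOME/STATUS.md 2026-08-23T12:42:19Z, free-target protocol G.5-34(d)); row **B3.Eq1.19-1.22** of
`HOME/lit-balaban-r15/ROWS-B3.md` ((1.21) p. 416; fold owner r15; head `proved` under the lead's HEAD WORD Q25 — this file is an OPTIONAL
located member of its (1.21) cell, zero head weight).  CONSUMES BY NAME: p26's `B3GraphAmplitude.Pairing` (`other`, `symm`, `ne`, `mate`,
`isLower`, `Line`, `Ext`, `lower_xor`, `mate_eq`, `isLower_iff`, `not_isLower_of_none`; p361338 lineage).  Nothing re-declared.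

THE PRINTED TEXT (verbatim).  p. 414 [PDF 4]: *"All the A′-legs are contracted, i.e. they are divided into pairs and each pair is
replaced by the corresponding propagator. Some φ′-legs are replaced by external scalar fields and the remaining are again divided into
pairs and each pair is replaced by a propagator"*; p. 415 [PDF 5]: *"Now a graph for us is a collection of internal lines, external
legs, and vertices connected in the usual sense. There is at least one internal line, and every internal line has a vertex at each
endpoint."*; p. 416 [PDF 6], (1.21): *"G^ε = Σ_{n=0}^{∞} C^ε_0[(−δm² + Σ^ε + ∂^{ε*}Σ^ε_1 + Σ^{ε*}_1∂^ε + ∂^{ε*}Σ^ε_2∂^ε)C^ε_0]ⁿ … Σ^ε,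
Σ^ε_1, Σ^ε_2 are given by amputated, one-particle-irreducible graphs of the expansion of G^ε."*

WHY THIS FILE.  In p26's evaluator `B3GraphAmplitude.amp` (p361338) every internal line contributes ONE kernel entry
`Ks l (α l.1) (α (mate l.1))`, the line `l` being represented by its endpoint of LOWER rank (`Pairing.Line rank`, `lower_xor`).  When
two graphs are glued along a new line (p37's `B3GraphGlue.glue`, p362777: the vertices of the second piece are shifted by
`Fin.natAdd`), the Cantor rank `Nat.pair (vertex, slot)` of FILE 1 does NOT keep the order of the legs of the second piece, so a line of
the second piece may change its representative in the glued graph.  The cure is bookkeeping, done here once for every species of legs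
(φ′, A′, outputs): read the per-line kernels as ORIENTED PAIR KERNELS `K x y` (the kernel of the line through `x` and `y`, read from `x`
to `y`; `K y x q p = K x y p q` on lines — `FlipSymm`), for which the line product does not depend on the rank (`lineProd_rank_indep`),
and compute the line product of the JOINT pairing of `L₁ ⊕ L₂` with one new line `a—b` (`Pairing.glueP`) resp. none (`Pairing.sumP`) for
the block rank `sumRank` (`lineProd_glueP`, `lineProd_sumP`); transport along a relabelling of the legs (`lineProd_transport`) carries
the result to the glued graph's own leg types in FILE K2.

WHAT IS TYPED / PROVED (definitions with bodies + theorems; no `Prop` fact, no `sorry`; standard axioms).  §1 `FlipSymm`, `lineK`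
(pair kernel ↦ per-line kernels), `pairK` (per-line kernels ↦ pair kernel), `lineK_pairK`, `pairK_flipSymm`, `lineProd`,
`lineProd_lineK`/`prod_line_eq_lineProd_pairK` (FILE 1's line factors are line products); §2 `other_eq_some_mate`, `mate_mate`,
`lowerRep` and **`lineProd_rank_indep`**; §3 `Pairing.transportP` (relabelling the legs along an equivalence), `isLower_transport`,
`mate_transport`, **`lineProd_transport`**, `other_transportP_eq_none_iff`; §4 `sumRank` + `sumRank_injective`, `Pairing.sumP` (disjoint
juxtaposition) with `isLower_sumP_inl/inr`, `mate_sumP_inl/inr`, **`lineProd_sumP`**, `Pairing.glueP` (juxtaposition + ONE NEW LINE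
a—b between external legs) with `isLower_glueP_*`, `mate_glueP_*`, **`lineProd_glueP`** (= the new line's kernel read from `a` to `b`
× the two old line products), `glueP_other_inl_eq_none_iff`/`_inr_` (the external legs of the glued pairing = the old ones minus `a`, `b`).
HONEST SCOPE.  Pure finite bookkeeping on p26's `Pairing` (any leg type, any commutative monoid of values); no graph is formed here
(FILE K2), nothing analytic; the «junk» value `1` of `pairK` off the lines is never met by a line product (`lineK_pairK`).  Unit
`lit-balaban-p37` gen 108 (literature-prover-lit-balaban-p37-g108-0), HOME `run/shared/lean/pub/lit-balaban/`, 2026-08-23.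
-/

open Finset
open scoped BigOperators

namespace Literature.MathematicalPhysics.QuantumFieldTheory.Balaban1983to89.B3PairingLineCalculus

open B3GraphAmplitude

/-! ## §1 Oriented pair kernels ↔ per-line kernels; the line product -/

section PairKernels

variable {L : Type*} (Pr : Pairing L) (rank : L → ℕ) {I M : Type*} [CommMonoid M]

/-- An ORIENTED PAIR KERNEL `K x y` (the kernel of the line through the legs `x`, `y`, read from `x` to `y`) is FLIP-SYMMETRIC on
the lines of the pairing: reading the line backwards transposes the kernel (p. 414: the pair *"replaced by the corresponding
propagator"* — a propagator entry `G(x,x′)` read from `x′` is `G(x′,x)`). [cite: Balaban1983Higgs3, p.414] -/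
def FlipSymm (K : L → L → I → I → M) : Prop :=
  ∀ ⦃x y : L⦄, Pr.other x = some y → ∀ p q : I, K x y p q = K y x q p

/-- The PER-LINE kernel of an oriented pair kernel: the line `l` (represented by its lower endpoint) carries `K l (mate l)` — the
shape in which FILE 1's `amp` consumes kernels (`Ks : Line → I → I → ℝ`). [cite: Balaban1983Higgs3, p.414] -/
def lineK (K : L → L → I → I → M) (l : Pr.Line rank) : I → I → M :=
  K l.1 (Pr.mate l.1)

/-- The ORIENTED PAIR KERNEL of a family of per-line kernels: from the lower endpoint it is the line's kernel, from the upper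
endpoint the transposed kernel (value `1` off the lines — never met by a line product). [cite: Balaban1983Higgs3, p.414] -/
def pairK (Ks : Pr.Line rank → I → I → M) (x y : L) (p q : I) : M :=
  if h : Pr.isLower rank x = true then Ks ⟨x, h⟩ p q
  else if h' : Pr.isLower rank y = true then Ks ⟨y, h'⟩ q p else 1

/-- kernel: per-line ∘ pair = identity on per-line kernels. [cite: Balaban1983Higgs3, p.414] -/
@[simp] theorem lineK_pairK (Ks : Pr.Line rank → I → I → M) (l : Pr.Line rank) :
    lineK Pr rank (pairK Pr rank Ks) l = Ks l := by
  funext p q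
  simp [lineK, pairK, l.2]

/-- kernel: the pair kernel of a per-line family is flip-symmetric on the lines (each line has exactly one lower endpoint).
[cite: Balaban1983Higgs3, p.415] -/
theorem pairK_flipSymm (hr : Function.Injective rank) (Ks : Pr.Line rank → I → I → M) :
    FlipSymm Pr (pairK Pr rank Ks) := by
  intro x y hxy p q
  rcases Pr.lower_xor rank hr hxy with ⟨hx, hy⟩ | ⟨hx, hy⟩
  · simp [pairK, hx, hy]
  · simp [pairK, hx, hy]

variable [Fintype L]

/-- **The LINE PRODUCT of an oriented pair kernel at an index assignment `α`**: over the internal lines (lower endpoints for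
`rank`) the kernel of the line between the indices of its two endpoints — FILE 1's `sLineFactor`/`vLineFactor`/`oLineFactor` read
through `lineK` (`lineProd_lineK`). [cite: Balaban1983Higgs3, p.414] -/
def lineProd (K : L → L → I → I → M) (α : L → I) : M :=
  ∏ l : Pr.Line rank, K l.1 (Pr.mate l.1) (α l.1) (α (Pr.mate l.1))

/-- kernel: the line product is FILE 1's shape `∏_l Ks l (α l) (α (mate l))` for `Ks = lineK K`. [cite: Balaban1983Higgs3, p.414] -/
theorem lineProd_eq_prod_lineK (K : L → L → I → I → M) (α : L → I) :
    lineProd Pr rank K α = ∏ l : Pr.Line rank, lineK Pr rank K l (α l.1) (α (Pr.mate l.1)) := rfl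

/-- kernel: FILE 1's shape for a per-line family `Ks` is the line product of its pair kernel. [cite: Balaban1983Higgs3, p.414] -/
theorem prod_line_eq_lineProd_pairK (Ks : Pr.Line rank → I → I → M) (α : L → I) :
    ∏ l : Pr.Line rank, Ks l (α l.1) (α (Pr.mate l.1)) = lineProd Pr rank (pairK Pr rank Ks) α := by
  rw [lineProd_eq_prod_lineK]
  simp

/-- kernel: the line product as a product over ALL legs with an indicator of the lower endpoints. [folklore] -/
private theorem lineProd_eq_prod_ite (K : L → L → I → I → M) (α : L → I) :
    lineProd Pr rank K α = ∏ x : L, if Pr.isLower rank x = true then K x (Pr.mate x) (α x) (α (Pr.mate x)) else 1 := by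
  unfold lineProd
  rw [← Finset.prod_subtype (Finset.univ.filter fun x : L => Pr.isLower rank x = true) (by simp)
    (fun x => K x (Pr.mate x) (α x) (α (Pr.mate x))), Finset.prod_filter]

end PairKernels

/-! ## §2 The line product does not depend on the rank that picks the representatives -/

section RankIndep

variable {L : Type*} (Pr : Pairing L) {I M : Type*} [CommMonoid M]

/-- kernel: an internal leg's line ends at its mate. [cite: Balaban1983Higgs3, p.415] -/
theorem other_eq_some_mate {rank : L → ℕ} {x : L} (h : Pr.isLower rank x = true) : Pr.other x = some (Pr.mate x) := by
  obtain ⟨y, hy, -⟩ := (Pr.isLower_iff rank x).1 h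
  rw [Pr.mate_eq hy]
  exact hy

/-- kernel: the mate of the mate of an internal leg is the leg. [cite: Balaban1983Higgs3, p.415] -/
theorem mate_mate {x y : L} (h : Pr.other x = some y) : Pr.mate (Pr.mate x) = x := by
  rw [Pr.mate_eq h, Pr.mate_eq (Pr.symm x y h)]

/-- kernel: the upper endpoint of a line is internal and not lower. [cite: Balaban1983Higgs3, p.415] -/
theorem isLower_mate_of_isLower {rank : L → ℕ} (hr : Function.Injective rank) {x : L} (h : Pr.isLower rank x = true) :
    Pr.isLower rank (Pr.mate x) = false := by
  rcases Pr.lower_xor rank hr (other_eq_some_mate Pr h) with ⟨-, h2⟩ | ⟨h1, -⟩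
  · exact h2
  · rw [h] at h1; cases h1

variable (rank rank' : L → ℕ)

/-- The representative for `rank'` of the line represented by `l` for `rank`: `l` itself or its mate.
[cite: Balaban1983Higgs3, p.415] -/
def lowerRep (hr' : Function.Injective rank') (l : Pr.Line rank) : Pr.Line rank' :=
  if h : Pr.isLower rank' l.1 = true then ⟨l.1, h⟩
  else ⟨Pr.mate l.1, by
    rcases Pr.lower_xor rank' hr' (other_eq_some_mate Pr l.2) with ⟨h1, -⟩ | ⟨-, h2⟩
    · exact absurd h1 h
    · exact h2⟩

variable {rank rank'}

/-- kernel: re-representing twice returns the line. [cite: Balaban1983Higgs3, p.415] -/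
theorem lowerRep_lowerRep (hr : Function.Injective rank) (hr' : Function.Injective rank') (l : Pr.Line rank) :
    lowerRep Pr rank' rank hr (lowerRep Pr rank rank' hr' l) = l := by
  by_cases h : Pr.isLower rank' l.1 = true
  · apply Subtype.ext
    simp [lowerRep, h, l.2]
  · apply Subtype.ext
    have hm : Pr.isLower rank (Pr.mate l.1) = false := isLower_mate_of_isLower Pr hr l.2
    simp [lowerRep, h, hm, mate_mate Pr (other_eq_some_mate Pr l.2)]

/-- The lines for `rank` and for `rank'` correspond (same lines, possibly the other endpoint as representative).
[cite: Balaban1983Higgs3, p.415] -/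
def lineEquivOfRank (hr : Function.Injective rank) (hr' : Function.Injective rank') : Pr.Line rank ≃ Pr.Line rank' where
  toFun := lowerRep Pr rank rank' hr'
  invFun := lowerRep Pr rank' rank hr
  left_inv := lowerRep_lowerRep Pr hr hr'
  right_inv := lowerRep_lowerRep Pr hr' hr

/-- **The line product of a flip-symmetric pair kernel does not depend on the rank**: two injective ranks represent the same
lines, possibly by the other endpoint, and reading a line backwards transposes the kernel together with its two indices.
[cite: Balaban1983Higgs3, p.414] -/
theorem lineProd_rank_indep [Fintype L] (hr : Function.Injective rank) (hr' : Function.Injective rank')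
    {K : L → L → I → I → M} (hK : FlipSymm Pr K) (α : L → I) :
    lineProd Pr rank K α = lineProd Pr rank' K α := by
  unfold lineProd
  refine Fintype.prod_equiv (lineEquivOfRank Pr hr hr') _ _ fun l => ?_
  change _ = K (lowerRep Pr rank rank' hr' l).1 (Pr.mate (lowerRep Pr rank rank' hr' l).1)
      (α (lowerRep Pr rank rank' hr' l).1) (α (Pr.mate (lowerRep Pr rank rank' hr' l).1))
  by_cases h : Pr.isLower rank' l.1 = true
  · simp [lowerRep, h]
  · simp only [lowerRep, dif_neg h]
    rw [mate_mate Pr (other_eq_some_mate Pr l.2)]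
    exact hK (other_eq_some_mate Pr l.2) _ _

end RankIndep

/-! ## §3 Relabelling the legs along an equivalence -/

section Transport

variable {L L' : Type*} (Pr : Pairing L) (e : L ≃ L')

/-- The pairing transported along a relabelling `e` of the legs: `other' (e x) = (other x).map e`. [cite: Balaban1983Higgs3, p.415] -/
def _root_.Literature.MathematicalPhysics.QuantumFieldTheory.Balaban1983to89.B3GraphAmplitude.Pairing.transportP :
    Pairing L' where
  other z := (Pr.other (e.symm z)).map e
  symm z w h := by
    obtain ⟨y, hy, rfl⟩ := Option.map_eq_some_iff.1 h
    simp [Pr.symm _ _ hy]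
  ne z w h := by
    obtain ⟨y, hy, rfl⟩ := Option.map_eq_some_iff.1 h
    intro hzw
    exact Pr.ne _ _ hy (by simpa using congrArg e.symm hzw)

/-- kernel: the transported pairing on relabelled legs. [cite: Balaban1983Higgs3, p.415] -/
@[simp] theorem transportP_other_apply (x : L) : (Pr.transportP e).other (e x) = (Pr.other x).map e := by
  simp [Pairing.transportP]

/-- kernel: a relabelled leg is external iff the leg is. [cite: Balaban1983Higgs3, p.415] -/
theorem other_transportP_eq_none_iff (z : L') : (Pr.transportP e).other z = none ↔ Pr.other (e.symm z) = none := by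
  simp [Pairing.transportP]

variable {Pr e} {Pr' : Pairing L'} (he : ∀ x, Pr'.other (e x) = (Pr.other x).map e)
  {rank : L → ℕ} {rank' : L' → ℕ} (hre : ∀ x, rank' (e x) = rank x)
include he

/-- kernel: relabelling commutes with `mate`. [cite: Balaban1983Higgs3, p.415] -/
theorem mate_transport (x : L) : Pr'.mate (e x) = e (Pr.mate x) := by
  unfold Pairing.mate
  rw [he x]
  cases Pr.other x <;> simp

/-- kernel: an external leg stays external under relabelling. [cite: Balaban1983Higgs3, p.415] -/
theorem other_transport_eq_none_iff (x : L) : Pr'.other (e x) = none ↔ Pr.other x = none := by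
  rw [he x]
  simp

/-- kernel: a flip-symmetric pair kernel read through the relabelling is flip-symmetric for the relabelled pairing.
[cite: Balaban1983Higgs3, p.414] -/
theorem flipSymm_transport {I M : Type*} {K : L → L → I → I → M} (hK : FlipSymm Pr K) :
    FlipSymm Pr' (fun z z' => K (e.symm z) (e.symm z')) := by
  intro z z' h p q
  obtain ⟨x, rfl⟩ := e.surjective z
  obtain ⟨x', rfl⟩ := e.surjective z'
  rw [he x] at h
  obtain ⟨y, hy, hyx⟩ := Option.map_eq_some_iff.1 h
  obtain rfl : y = x' := e.injective hyx
  simpa using hK hy p q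

include hre

/-- kernel: relabelling with matching ranks keeps the lower endpoints. [cite: Balaban1983Higgs3, p.415] -/
theorem isLower_transport (x : L) : Pr'.isLower rank' (e x) = Pr.isLower rank x := by
  unfold Pairing.isLower
  rw [he x]
  cases h : Pr.other x with
  | none => simp
  | some y => simp [hre]

/-- The lines correspond under a relabelling with matching ranks. [cite: Balaban1983Higgs3, p.415] -/
def lineEquivTransport : Pr.Line rank ≃ Pr'.Line rank' where
  toFun l := ⟨e l.1, by rw [isLower_transport he hre]; exact l.2⟩
  invFun l' := ⟨e.symm l'.1, by rw [← isLower_transport (Pr' := Pr') (e := e) he hre, e.apply_symm_apply]; exact l'.2⟩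
  left_inv l := by simp
  right_inv l' := by simp

/-- **The line product is transported along a relabelling of the legs** with matching pairings and ranks: the glued graph's
line product is computed on `L₁ ⊕ L₂` (FILE K2). [cite: Balaban1983Higgs3, p.414] -/
theorem lineProd_transport [Fintype L] [Fintype L'] {I M : Type*} [CommMonoid M] (K' : L' → L' → I → I → M) (α' : L' → I) :
    lineProd Pr' rank' K' α' = lineProd Pr rank (fun x y => K' (e x) (e y)) (α' ∘ e) := by
  unfold lineProd
  refine (Fintype.prod_equiv (lineEquivTransport he hre) _ _ fun l => ?_).symm
  simp [lineEquivTransport, mate_transport he]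

end Transport

/-! ## §4 The joint pairing of two leg species: disjoint, or glued along one new line -/

section Joint

variable {L₁ L₂ : Type*} (Pr₁ : Pairing L₁) (Pr₂ : Pairing L₂)

/-- The BLOCK RANK on `L₁ ⊕ L₂`: the legs of the first species first (in their order), then those of the second (in theirs).
[cite: Balaban1983Higgs3, p.415] -/
def sumRank [Fintype L₁] (r₁ : L₁ → ℕ) (r₂ : L₂ → ℕ) : L₁ ⊕ L₂ → ℕ :=
  Sum.elim r₁ fun y => (Finset.univ.sup r₁ + 1) + r₂ y

/-- kernel: a first-block rank is below every second-block rank. [folklore] -/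
private theorem sumRank_inl_lt_inr [Fintype L₁] (r₁ : L₁ → ℕ) (r₂ : L₂ → ℕ) (x : L₁) (y : L₂) :
    sumRank r₁ r₂ (.inl x) < sumRank r₁ r₂ (.inr y) := by
  have hx : r₁ x ≤ Finset.univ.sup r₁ := Finset.le_sup (Finset.mem_univ x)
  simp [sumRank]
  omega

/-- kernel: the block rank is injective when both ranks are (so it may orient the lines, p. 415). [cite: Balaban1983Higgs3, p.415] -/
theorem sumRank_injective [Fintype L₁] {r₁ : L₁ → ℕ} {r₂ : L₂ → ℕ} (h₁ : Function.Injective r₁)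
    (h₂ : Function.Injective r₂) : Function.Injective (sumRank r₁ r₂) := by
  rintro (x | y) (x' | y') h
  · have : r₁ x = r₁ x' := by simpa [sumRank] using h
    rw [h₁ this]
  · exact absurd h (sumRank_inl_lt_inr r₁ r₂ x y').ne
  · exact absurd h.symm (sumRank_inl_lt_inr r₁ r₂ x' y).ne
  · have : r₂ y = r₂ y' := by simpa [sumRank] using h
    rw [h₂ this]

/-- The DISJOINT juxtaposition of two pairings (no line between the two species: the A′-lines and the output pairs of a glued
graph). [cite: Balaban1983Higgs3, p.415] -/
def _root_.Literature.MathematicalPhysics.QuantumFieldTheory.Balaban1983to89.B3GraphAmplitude.Pairing.sumP :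
    Pairing (L₁ ⊕ L₂) where
  other
    | .inl x => (Pr₁.other x).map Sum.inl
    | .inr y => (Pr₂.other y).map Sum.inr
  symm := by
    rintro (x | y) (x' | y') h
    · obtain ⟨z, hz, hzz⟩ := Option.map_eq_some_iff.1 h
      cases hzz
      simp [Pr₁.symm _ _ hz]
    · simp at h
    · simp at h
    · obtain ⟨z, hz, hzz⟩ := Option.map_eq_some_iff.1 h
      cases hzz
      simp [Pr₂.symm _ _ hz]
  ne := by
    rintro (x | y) (x' | y') h
    · obtain ⟨z, hz, hzz⟩ := Option.map_eq_some_iff.1 h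
      cases hzz
      simpa using Pr₁.ne _ _ hz
    · simp at h
    · simp at h
    · obtain ⟨z, hz, hzz⟩ := Option.map_eq_some_iff.1 h
      cases hzz
      simpa using Pr₂.ne _ _ hz

/-- kernel: the juxtaposed pairing on the first species. [cite: Balaban1983Higgs3, p.415] -/
@[simp] theorem sumP_other_inl (x : L₁) : (Pr₁.sumP Pr₂).other (.inl x) = (Pr₁.other x).map Sum.inl := rfl

/-- kernel: the juxtaposed pairing on the second species. [cite: Balaban1983Higgs3, p.415] -/
@[simp] theorem sumP_other_inr (y : L₂) : (Pr₁.sumP Pr₂).other (.inr y) = (Pr₂.other y).map Sum.inr := rfl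

/-- kernel: mates in the first block. [cite: Balaban1983Higgs3, p.415] -/
@[simp] theorem mate_sumP_inl (x : L₁) : (Pr₁.sumP Pr₂).mate (.inl x) = .inl (Pr₁.mate x) := by
  unfold Pairing.mate
  rw [sumP_other_inl]
  cases Pr₁.other x <;> simp

/-- kernel: mates in the second block. [cite: Balaban1983Higgs3, p.415] -/
@[simp] theorem mate_sumP_inr (y : L₂) : (Pr₁.sumP Pr₂).mate (.inr y) = .inr (Pr₂.mate y) := by
  unfold Pairing.mate
  rw [sumP_other_inr]
  cases Pr₂.other y <;> simp

/-- The JOINT PAIR KERNEL on `L₁ ⊕ L₂`: the old pair kernels inside each block, `Knew` from the first block to the second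
(the kernel of a new line a—b read from `a` to `b`) and its transpose backwards. [cite: Balaban1983Higgs3, (1.21) p.416] -/
def jointK {I M : Type*} (K₁ : L₁ → L₁ → I → I → M) (K₂ : L₂ → L₂ → I → I → M) (Knew : I → I → M) :
    L₁ ⊕ L₂ → L₁ ⊕ L₂ → I → I → M
  | .inl x, .inl x' => K₁ x x'
  | .inr y, .inr y' => K₂ y y'
  | .inl _, .inr _ => Knew
  | .inr _, .inl _ => fun p q => Knew q p

/-- kernel: the joint pair kernel is flip-symmetric for the disjoint juxtaposition if the blocks are.
[cite: Balaban1983Higgs3, p.414] -/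
theorem jointK_flipSymm_sumP {I M : Type*} {K₁ : L₁ → L₁ → I → I → M} {K₂ : L₂ → L₂ → I → I → M}
    (h₁ : FlipSymm Pr₁ K₁) (h₂ : FlipSymm Pr₂ K₂) (Knew : I → I → M) :
    FlipSymm (Pr₁.sumP Pr₂) (jointK K₁ K₂ Knew) := by
  rintro (x | y) (x' | y') h p q
  · obtain ⟨z, hz, hzz⟩ := Option.map_eq_some_iff.1 h
    cases hzz
    exact h₁ hz p q
  · simp at h
  · simp at h
  · obtain ⟨z, hz, hzz⟩ := Option.map_eq_some_iff.1 h
    cases hzz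
    exact h₂ hz p q

section SumLower

variable [Fintype L₁] (r₁ : L₁ → ℕ) (r₂ : L₂ → ℕ)


/-- kernel: lower endpoints in the first block are the old ones. [cite: Balaban1983Higgs3, p.415] -/
@[simp] theorem isLower_sumP_inl (x : L₁) :
    (Pr₁.sumP Pr₂).isLower (sumRank r₁ r₂) (.inl x) = Pr₁.isLower r₁ x := by
  unfold Pairing.isLower
  rw [sumP_other_inl]
  cases Pr₁.other x <;> simp [sumRank]

/-- kernel: lower endpoints in the second block are the old ones (the block shift keeps the order). [cite: Balaban1983Higgs3, p.415] -/
@[simp] theorem isLower_sumP_inr (y : L₂) :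
    (Pr₁.sumP Pr₂).isLower (sumRank r₁ r₂) (.inr y) = Pr₂.isLower r₂ y := by
  unfold Pairing.isLower
  rw [sumP_other_inr]
  cases Pr₂.other y <;> simp [sumRank]

/-- **The line product of the disjoint juxtaposition is the product of the two line products.** [cite: Balaban1983Higgs3, p.414] -/
theorem lineProd_sumP [Fintype L₂] {I M : Type*} [CommMonoid M] (K : L₁ ⊕ L₂ → L₁ ⊕ L₂ → I → I → M) (α : L₁ ⊕ L₂ → I) :
    lineProd (Pr₁.sumP Pr₂) (sumRank r₁ r₂) K α =
      lineProd Pr₁ r₁ (fun x x' => K (.inl x) (.inl x')) (α ∘ Sum.inl) *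
        lineProd Pr₂ r₂ (fun y y' => K (.inr y) (.inr y')) (α ∘ Sum.inr) := by
  simp only [lineProd_eq_prod_ite, Fintype.prod_sum_type, isLower_sumP_inl, isLower_sumP_inr, mate_sumP_inl, mate_sumP_inr,
    Function.comp_apply]

/-- **The line product of the juxtaposition for the joint pair kernel is the product of the blocks' line products.**
[cite: Balaban1983Higgs3, p.414] -/
theorem lineProd_sumP_jointK [Fintype L₂] {I M : Type*} [CommMonoid M] (K₁ : L₁ → L₁ → I → I → M)
    (K₂ : L₂ → L₂ → I → I → M) (Knew : I → I → M) (α : L₁ ⊕ L₂ → I) :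
    lineProd (Pr₁.sumP Pr₂) (sumRank r₁ r₂) (jointK K₁ K₂ Knew) α =
      lineProd Pr₁ r₁ K₁ (α ∘ Sum.inl) * lineProd Pr₂ r₂ K₂ (α ∘ Sum.inr) :=
  lineProd_sumP Pr₁ Pr₂ r₁ r₂ _ α

end SumLower

section Glue

variable [DecidableEq L₁] [DecidableEq L₂] (a : L₁) (b : L₂) (ha : Pr₁.other a = none) (hb : Pr₂.other b = none)

/-- **The juxtaposition of two pairings GLUED ALONG ONE NEW LINE** between the external leg `a` of the first species and the
external leg `b` of the second (p37's `B3GraphGlueLegs.jointOther` at the level of p26's pairings): the old lines are kept, `a` and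
`b` become the two endpoints of the new line (in (1.21): a propagator C₀^ε between two 1PI insertions). [cite: Balaban1983Higgs3, (1.21) p.416] -/
def _root_.Literature.MathematicalPhysics.QuantumFieldTheory.Balaban1983to89.B3GraphAmplitude.Pairing.glueP :
    Pairing (L₁ ⊕ L₂) where
  other
    | .inl x => if x = a then some (.inr b) else (Pr₁.other x).map Sum.inl
    | .inr y => if y = b then some (.inl a) else (Pr₂.other y).map Sum.inr
  symm := by
    rintro (x | y) (x' | y') h
    · by_cases hx : x = a
      · simp [hx] at h
      · simp only [hx, if_false] at h
        obtain ⟨z, hz, hzz⟩ := Option.map_eq_some_iff.1 h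
        cases hzz
        have hx' : x' ≠ a := by rintro rfl; rw [Pr₁.symm _ _ hz] at ha; cases ha
        simp [hx', Pr₁.symm _ _ hz]
    · by_cases hx : x = a
      · subst hx
        simp only [if_true, Option.some.injEq, Sum.inr.injEq] at h
        subst h
        simp
      · simp [hx] at h
    · by_cases hy : y = b
      · subst hy
        simp only [if_true, Option.some.injEq, Sum.inl.injEq] at h
        subst h
        simp
      · simp [hy] at h
    · by_cases hy : y = b
      · simp [hy] at h
      · simp only [hy, if_false] at h
        obtain ⟨z, hz, hzz⟩ := Option.map_eq_some_iff.1 h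
        cases hzz
        have hy' : y' ≠ b := by rintro rfl; rw [Pr₂.symm _ _ hz] at hb; cases hb
        simp [hy', Pr₂.symm _ _ hz]
  ne := by
    rintro (x | y) (x' | y') h
    · by_cases hx : x = a
      · simp [hx] at h
      · simp only [hx, if_false] at h
        obtain ⟨z, hz, hzz⟩ := Option.map_eq_some_iff.1 h
        cases hzz
        simpa using Pr₁.ne _ _ hz
    · simp
    · simp
    · by_cases hy : y = b
      · simp [hy] at h
      · simp only [hy, if_false] at h
        obtain ⟨z, hz, hzz⟩ := Option.map_eq_some_iff.1 h
        cases hzz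
        simpa using Pr₂.ne _ _ hz

/-- kernel: the new line, read from the first side. [cite: Balaban1983Higgs3, (1.21) p.416] -/
@[simp] theorem glueP_other_inl_self : (Pr₁.glueP Pr₂ a b ha hb).other (.inl a) = some (.inr b) := by
  simp [Pairing.glueP]

/-- kernel: the new line, read from the second side. [cite: Balaban1983Higgs3, (1.21) p.416] -/
@[simp] theorem glueP_other_inr_self : (Pr₁.glueP Pr₂ a b ha hb).other (.inr b) = some (.inl a) := by
  simp [Pairing.glueP]

variable {a b}

/-- kernel: the old lines of the first side are kept. [cite: Balaban1983Higgs3, (1.21) p.416] -/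
@[simp] theorem glueP_other_inl_of_ne {x : L₁} (hx : x ≠ a) :
    (Pr₁.glueP Pr₂ a b ha hb).other (.inl x) = (Pr₁.other x).map Sum.inl := by
  simp [Pairing.glueP, hx]

/-- kernel: the old lines of the second side are kept. [cite: Balaban1983Higgs3, (1.21) p.416] -/
@[simp] theorem glueP_other_inr_of_ne {y : L₂} (hy : y ≠ b) :
    (Pr₁.glueP Pr₂ a b ha hb).other (.inr y) = (Pr₂.other y).map Sum.inr := by
  simp [Pairing.glueP, hy]

/-- **The external legs of the glued pairing on the first side are the old external legs other than `a`.**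
[cite: Balaban1983Higgs3, (1.21) p.416] -/
theorem glueP_other_inl_eq_none_iff (x : L₁) :
    (Pr₁.glueP Pr₂ a b ha hb).other (.inl x) = none ↔ x ≠ a ∧ Pr₁.other x = none := by
  by_cases hx : x = a
  · subst hx; simp
  · simp [hx]

/-- **The external legs of the glued pairing on the second side are the old external legs other than `b`.**
[cite: Balaban1983Higgs3, (1.21) p.416] -/
theorem glueP_other_inr_eq_none_iff (y : L₂) :
    (Pr₁.glueP Pr₂ a b ha hb).other (.inr y) = none ↔ y ≠ b ∧ Pr₂.other y = none := by
  by_cases hy : y = b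
  · subst hy; simp
  · simp [hy]

/-- kernel: the mate of `a` is `b`. [cite: Balaban1983Higgs3, (1.21) p.416] -/
@[simp] theorem mate_glueP_inl_self : (Pr₁.glueP Pr₂ a b ha hb).mate (.inl a) = .inr b := by
  simp [Pairing.mate]

/-- kernel: the mate of `b` is `a`. [cite: Balaban1983Higgs3, (1.21) p.416] -/
@[simp] theorem mate_glueP_inr_self : (Pr₁.glueP Pr₂ a b ha hb).mate (.inr b) = .inl a := by
  simp [Pairing.mate]

/-- kernel: old mates on the first side. [cite: Balaban1983Higgs3, (1.21) p.416] -/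
@[simp] theorem mate_glueP_inl_of_ne {x : L₁} (hx : x ≠ a) :
    (Pr₁.glueP Pr₂ a b ha hb).mate (.inl x) = .inl (Pr₁.mate x) := by
  unfold Pairing.mate
  rw [glueP_other_inl_of_ne Pr₁ Pr₂ ha hb hx]
  cases Pr₁.other x <;> simp

/-- kernel: old mates on the second side. [cite: Balaban1983Higgs3, (1.21) p.416] -/
@[simp] theorem mate_glueP_inr_of_ne {y : L₂} (hy : y ≠ b) :
    (Pr₁.glueP Pr₂ a b ha hb).mate (.inr y) = .inr (Pr₂.mate y) := by
  unfold Pairing.mate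
  rw [glueP_other_inr_of_ne Pr₁ Pr₂ ha hb hy]
  cases Pr₂.other y <;> simp

variable [Fintype L₁] (r₁ : L₁ → ℕ) (r₂ : L₂ → ℕ)

/-- kernel: `a` is the LOWER endpoint of the new line for the block rank. [cite: Balaban1983Higgs3, (1.21) p.416] -/
@[simp] theorem isLower_glueP_inl_self : (Pr₁.glueP Pr₂ a b ha hb).isLower (sumRank r₁ r₂) (.inl a) = true := by
  unfold Pairing.isLower
  rw [glueP_other_inl_self]
  simpa using sumRank_inl_lt_inr r₁ r₂ a b

/-- kernel: `b` is the upper endpoint of the new line. [cite: Balaban1983Higgs3, (1.21) p.416] -/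
@[simp] theorem isLower_glueP_inr_self : (Pr₁.glueP Pr₂ a b ha hb).isLower (sumRank r₁ r₂) (.inr b) = false := by
  unfold Pairing.isLower
  rw [glueP_other_inr_self]
  simpa using (sumRank_inl_lt_inr r₁ r₂ a b).le

/-- kernel: old lower endpoints on the first side. [cite: Balaban1983Higgs3, (1.21) p.416] -/
@[simp] theorem isLower_glueP_inl_of_ne {x : L₁} (hx : x ≠ a) :
    (Pr₁.glueP Pr₂ a b ha hb).isLower (sumRank r₁ r₂) (.inl x) = Pr₁.isLower r₁ x := by
  unfold Pairing.isLower
  rw [glueP_other_inl_of_ne Pr₁ Pr₂ ha hb hx]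
  cases Pr₁.other x <;> simp [sumRank]

/-- kernel: old lower endpoints on the second side (the block shift keeps the order). [cite: Balaban1983Higgs3, (1.21) p.416] -/
@[simp] theorem isLower_glueP_inr_of_ne {y : L₂} (hy : y ≠ b) :
    (Pr₁.glueP Pr₂ a b ha hb).isLower (sumRank r₁ r₂) (.inr y) = Pr₂.isLower r₂ y := by
  unfold Pairing.isLower
  rw [glueP_other_inr_of_ne Pr₁ Pr₂ ha hb hy]
  cases Pr₂.other y <;> simp [sumRank]

/-- **The line product of the glued pairing = the kernel of the NEW LINE read from `a` to `b` × the line product of the first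
side × the line product of the second side** (for the block rank; any other injective rank by `lineProd_rank_indep`).  This is the
bookkeeping behind «cutting the new line» in FILE K2. [cite: Balaban1983Higgs3, (1.21) p.416] -/
theorem lineProd_glueP [Fintype L₂] {I M : Type*} [CommMonoid M] (K : L₁ ⊕ L₂ → L₁ ⊕ L₂ → I → I → M) (α : L₁ ⊕ L₂ → I) :
    lineProd (Pr₁.glueP Pr₂ a b ha hb) (sumRank r₁ r₂) K α =
      K (.inl a) (.inr b) (α (.inl a)) (α (.inr b)) *
        (lineProd Pr₁ r₁ (fun x x' => K (.inl x) (.inl x')) (α ∘ Sum.inl) *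
          lineProd Pr₂ r₂ (fun y y' => K (.inr y) (.inr y')) (α ∘ Sum.inr)) := by
  simp only [lineProd_eq_prod_ite, Fintype.prod_sum_type, Function.comp_apply]
  have h1 : (∏ x : L₁, if (Pr₁.glueP Pr₂ a b ha hb).isLower (sumRank r₁ r₂) (.inl x) = true then
        K (.inl x) ((Pr₁.glueP Pr₂ a b ha hb).mate (.inl x)) (α (.inl x)) (α ((Pr₁.glueP Pr₂ a b ha hb).mate (.inl x)))
        else 1) =
      (∏ x : L₁, if x = a then K (.inl a) (.inr b) (α (.inl a)) (α (.inr b)) else 1) *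
        ∏ x : L₁, if Pr₁.isLower r₁ x = true then K (.inl x) (.inl (Pr₁.mate x)) (α (.inl x)) (α (.inl (Pr₁.mate x)))
          else 1 := by
    rw [← Finset.prod_mul_distrib]
    refine Finset.prod_congr rfl fun x _ => ?_
    by_cases hx : x = a
    · subst hx
      simp [Pr₁.not_isLower_of_none r₁ ha]
    · simp [hx, isLower_glueP_inl_of_ne Pr₁ Pr₂ ha hb r₁ r₂ hx, mate_glueP_inl_of_ne Pr₁ Pr₂ ha hb hx]
  have h2 : (∏ y : L₂, if (Pr₁.glueP Pr₂ a b ha hb).isLower (sumRank r₁ r₂) (.inr y) = true then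
        K (.inr y) ((Pr₁.glueP Pr₂ a b ha hb).mate (.inr y)) (α (.inr y)) (α ((Pr₁.glueP Pr₂ a b ha hb).mate (.inr y)))
        else 1) =
      ∏ y : L₂, if Pr₂.isLower r₂ y = true then K (.inr y) (.inr (Pr₂.mate y)) (α (.inr y)) (α (.inr (Pr₂.mate y)))
        else 1 := by
    refine Finset.prod_congr rfl fun y _ => ?_
    by_cases hy : y = b
    · subst hy
      simp [Pr₂.not_isLower_of_none r₂ hb]
    · simp [isLower_glueP_inr_of_ne Pr₁ Pr₂ ha hb r₁ r₂ hy, mate_glueP_inr_of_ne Pr₁ Pr₂ ha hb hy]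
  rw [h1, h2, Finset.prod_ite_eq']
  simp [mul_assoc]

omit [Fintype L₁] in
/-- kernel: the joint pair kernel is flip-symmetric for the glued pairing if the blocks are (the new line is read forwards from
`a`, backwards from `b`). [cite: Balaban1983Higgs3, (1.21) p.416] -/
theorem jointK_flipSymm_glueP {I M : Type*} {K₁ : L₁ → L₁ → I → I → M} {K₂ : L₂ → L₂ → I → I → M}
    (h₁ : FlipSymm Pr₁ K₁) (h₂ : FlipSymm Pr₂ K₂) (Knew : I → I → M) :
    FlipSymm (Pr₁.glueP Pr₂ a b ha hb) (jointK K₁ K₂ Knew) := by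
  rintro (x | y) (x' | y') h p q
  · by_cases hx : x = a
    · subst hx; simp at h
    · rw [glueP_other_inl_of_ne Pr₁ Pr₂ ha hb hx] at h
      obtain ⟨z, hz, hzz⟩ := Option.map_eq_some_iff.1 h
      cases hzz
      exact h₁ hz p q
  · rfl
  · rfl
  · by_cases hy : y = b
    · subst hy; simp at h
    · rw [glueP_other_inr_of_ne Pr₁ Pr₂ ha hb hy] at h
      obtain ⟨z, hz, hzz⟩ := Option.map_eq_some_iff.1 h
      cases hzz
      exact h₂ hz p q

/-- **The line product of the glued pairing for the joint pair kernel: the new line's kernel between the indices of `a` and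
`b`, times the blocks' line products.** [cite: Balaban1983Higgs3, (1.21) p.416] -/
theorem lineProd_glueP_jointK [Fintype L₂] {I M : Type*} [CommMonoid M] (K₁ : L₁ → L₁ → I → I → M)
    (K₂ : L₂ → L₂ → I → I → M) (Knew : I → I → M) (α : L₁ ⊕ L₂ → I) :
    lineProd (Pr₁.glueP Pr₂ a b ha hb) (sumRank r₁ r₂) (jointK K₁ K₂ Knew) α =
      Knew (α (.inl a)) (α (.inr b)) * (lineProd Pr₁ r₁ K₁ (α ∘ Sum.inl) * lineProd Pr₂ r₂ K₂ (α ∘ Sum.inr)) :=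
  lineProd_glueP Pr₁ Pr₂ ha hb r₁ r₂ _ α

end Glue

end Joint

end Literature.MathematicalPhysics.QuantumFieldTheory.Balaban1983to89.B3PairingLineCalculus
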